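import Literature.NumberTheory.Transcendental.FormIntegration
import HarnessLib

/-!
# Bridge lemma: a smooth Riemannian volume form gives a continuous orientation (proof)

This file discharges the named fact
`Literature.NumberTheory.Transcendental.isContinuousOrientation_of_isSmoothForm_riemannianVolumeForm`
of `Literature/NumberTheory/Transcendental/FormIntegration.lean`:
under a Riemannian metric on `M`, if the Riemannian volume form `vol_o = riemannianVolumeForm o`
of a pointwise orientation family `o` is a smooth form (`IsSmoothForm`), then `o` is a
continuous orientation (`IsContinuousOrientation o`: the orientation sign of every chart is
locally constant and nonzero at the chart centre).

## The printed result and its proof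

Lee, *Introduction to Smooth Manifolds* (2nd ed.), Ch. 15, p. 380 (continuous pointwise
orientations) and **Prop. 15.5** (the orientation determined by a nonvanishing `n`-form): a
nonvanishing continuous `n`-form `ω` determines a *continuous* pointwise orientation, because
on a local frame `(E_i)` one has `ω(E_1, …, E_n) = f ≠ 0` with `f` continuous, so `f` has
constant sign near each point. Here `ω = vol_o`, which at every point is a positively oriented
nonzero `n`-covector for `o` (Mathlib's `Orientation.volumeForm`; Lee, Prop. 15.29), and the
local frame is the coordinate frame of the extended chart at `x₀`.

## Proof architecture (Lean)

With `g y := (vol_o).inChart x₀ y (e₁, …, eₙ) = vol_{o(x)}(chart frame at y)`, `x = chart⁻¹ y`: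
* `chartSign o x₀ y = Real.sign (g y)` (`chartSign_eq_sign_inChart_riemannianVolumeForm`),
  since the representative `(o x).someVector` and `(o x).volumeForm` span the same ray
  (`sameRay_someVector_volumeForm`, from `Orientation.volumeForm_robust(_neg)`);
* `g` is continuous within `range I` at the chart centre (`IsSmoothForm` is `C^∞` there, and
  evaluation of a continuous alternating map at a fixed tuple is continuous);
* `g (centre) ≠ 0`: the derivative of `chart⁻¹` at the centre is invertible
  (`isInvertible_mfderivWithin_extChartAt_symm`), so the chart frame is a basis, on which the
  nonzero top form `vol` does not vanish (`AlternatingMap.map_basis_ne_zero_iff`);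
* hence `Real.sign ∘ g` is eventually equal to its (nonzero) value at the centre.

The continuity-of-the-metric instance `[IsContinuousRiemannianBundle …]` quantified in the fact
is not used by the argument: only chart-centre germs of `vol_o` enter, and their regularity is
the hypothesis `IsSmoothForm vol_o` itself.

## References

* J. M. Lee, *Introduction to Smooth Manifolds*, 2nd ed., GTM 218, Springer (2013), Ch. 15,
  p. 380 and Prop. 15.5, Prop. 15.29. [cite: Lee2013, Prop. 15.5]
-/

noncomputable section

open scoped Manifold ContDiff Topology
open Bundle Set Module Filter

namespace Literature.NumberTheory.Transcendental

/-! ### Pointwise: the volume form lies in the ray of its orientation -/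

section Pointwise

variable {V : Type*} [NormedAddCommGroup V] [InnerProductSpace ℝ V] [FiniteDimensional ℝ V]
  {n : ℕ} [Fact (finrank ℝ V = n)]

/-- Multiplication by a positive constant does not change `Real.sign`. [folklore] -/
theorem real_sign_mul_of_pos {c : ℝ} (hc : 0 < c) (t : ℝ) : Real.sign (c * t) = Real.sign t := by
  rcases lt_trichotomy t 0 with ht | rfl | ht
  · rw [Real.sign_of_neg ht, Real.sign_of_neg (mul_neg_of_pos_of_neg hc ht)]
  · rw [mul_zero]
  · rw [Real.sign_of_pos ht, Real.sign_of_pos (mul_pos hc ht)]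

/-- The volume form of an orientation `r` of a finite-dimensional real inner product space is
*positively oriented* for `r`: a representative `r.someVector` of the ray `r` and
`r.volumeForm` lie on the same ray (both are positive multiples of `det` of an `r`-oriented
orthonormal basis; Mathlib's `Orientation.volumeForm_robust` / `volumeForm_robust_neg`).
Lee (2013), Prop. 15.29 (the Riemannian volume form is an orientation form for the given
orientation). [cite: Lee2013, Prop. 15.29] -/
theorem sameRay_someVector_volumeForm (r : Orientation ℝ V (Fin n)) :
    SameRay ℝ r.someVector r.volumeForm := by
  let b := Literature.Geometry.Kaehler.stdOrthonormalBasisFin V n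
  rcases b.toBasis.orientation_eq_or_eq_neg r with h | h
  · rw [r.volumeForm_robust b h.symm, ← ray_eq_iff (R := ℝ) (Module.Ray.someVector_ne_zero r)
      b.toBasis.det_ne_zero, Module.Ray.someVector_ray]
    exact h
  · have hne : b.toBasis.orientation ≠ r := fun e ↦ Module.Ray.ne_neg_self _ (e.trans h)
    rw [r.volumeForm_robust_neg b hne, ← ray_eq_iff (R := ℝ) (Module.Ray.someVector_ne_zero r)
      (neg_ne_zero.2 b.toBasis.det_ne_zero), Module.Ray.someVector_ray,
      ← neg_rayOfNeZero ℝ _ b.toBasis.det_ne_zero]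
    exact h

/-- The volume form of an oriented finite-dimensional real inner product space is a nonzero
top-degree alternating form (it has absolute value `1` on an orthonormal basis,
`Orientation.abs_volumeForm_apply_of_orthonormal`). Lee (2013), Prop. 15.29. [cite: Lee2013, Prop. 15.29] -/
theorem volumeForm_ne_zero (r : Orientation ℝ V (Fin n)) : r.volumeForm ≠ 0 := fun h ↦ by
  simpa [h] using
    r.abs_volumeForm_apply_of_orthonormal (Literature.Geometry.Kaehler.stdOrthonormalBasisFin V n)

/-- On every `n`-tuple of vectors, a representative `r.someVector` of the orientation `r` and the
volume form `r.volumeForm` have the same sign (they are positive multiples of each other,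
`sameRay_someVector_volumeForm`). Lee (2013), Prop. 15.3 / 15.29. [cite: Lee2013, Prop. 15.29] -/
theorem sign_someVector_apply_eq_sign_volumeForm_apply (r : Orientation ℝ V (Fin n))
    (v : Fin n → V) : Real.sign (r.someVector v) = Real.sign (r.volumeForm v) := by
  obtain ⟨c, hc, hcv⟩ := (sameRay_someVector_volumeForm r).exists_pos_right
    (Module.Ray.someVector_ne_zero r) (volumeForm_ne_zero r)
  rw [hcv, AlternatingMap.smul_apply, smul_eq_mul, real_sign_mul_of_pos hc]

end Pointwise

/-! ### The bridge lemma -/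

section Bridge

variable {E : Type*} [NormedAddCommGroup E] [NormedSpace ℝ E] [FiniteDimensional ℝ E]
  {n : ℕ} [Fact (finrank ℝ E = n)]
  {H : Type*} [TopologicalSpace H] {I : ModelWithCorners ℝ E H}
  {M : Type*} [TopologicalSpace M] [ChartedSpace H M]
  (o : (x : M) → Orientation ℝ (TangentSpace I x) (Fin n))
  [RiemannianBundle (fun x : M ↦ TangentSpace I x)]

/-- **Chart signs are the signs of the volume form on the chart frame.** For a Riemannian
metric and an orientation family `o`, the orientation sign `chartSign o x₀ y` of the chart at
`x₀` equals the sign of the chart representative of `vol_o` evaluated on the reference frame,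
`Real.sign ((vol_o).inChart x₀ y (e₁, …, eₙ))`, because `vol_{o(x)}` is positively oriented for
`o(x)` at every point. Lee (2013), Prop. 15.5 (proof) with Prop. 15.29. [cite: Lee2013, Prop. 15.5] -/
theorem chartSign_eq_sign_inChart_riemannianVolumeForm (x₀ : M) (y : E) :
    chartSign o x₀ y =
      Real.sign ((Literature.Geometry.Kaehler.riemannianVolumeForm o).inChart x₀ y
        (modelBasis E n)) :=
  sign_someVector_apply_eq_sign_volumeForm_apply _ _

variable [IsManifold I ∞ M]

/-- At the centre of the chart at `x₀`, the chart representative of the Riemannian volume form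
does not vanish on the reference frame: the derivative of `(extChartAt I x₀).symm` there is
invertible (`isInvertible_mfderivWithin_extChartAt_symm`), so the chart frame is a basis of
`T_{x₀}M`, and a nonzero top-degree form is nonzero on a basis. Lee (2013), Prop. 15.5 (proof:
`ω(E_1, …, E_n) = f ≠ 0`). [cite: Lee2013, Prop. 15.5] -/
theorem inChart_riemannianVolumeForm_extChartAt_self_ne_zero (x₀ : M) :
    (Literature.Geometry.Kaehler.riemannianVolumeForm o).inChart x₀ (extChartAt I x₀ x₀)
      (modelBasis E n) ≠ 0 := by
  obtain ⟨e, he⟩ := isInvertible_mfderivWithin_extChartAt_symm (I := I) (mem_extChartAt_target x₀)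
  rw [Literature.Geometry.Kaehler.MForm.inChart_apply, ← he]
  exact (AlternatingMap.map_basis_ne_zero_iff ((modelBasis E n).map e.toLinearEquiv) _).2
    (volumeForm_ne_zero _)

/-- **Bridge lemma, discharged** (metric ⇒ metric-free orientation hypothesis): if the
Riemannian volume form `vol_o` of the orientation family `o` is a smooth form, then `o` is a
continuous orientation. Printed source: Lee (2013), Ch. 15, p. 380 (continuous pointwise
orientations) and Prop. 15.5 (a nonvanishing continuous `n`-form determines a continuous
orientation: `ω(E_1, …, E_n) = f ≠ 0` is continuous, hence of locally constant sign), applied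
to `ω = vol_o`, which is positively oriented for `o` at each point (Prop. 15.29). In chart terms:
`chartSign o x₀ = Real.sign ∘ g` with `g y = vol_o.inChart x₀ y (e)` continuous within `range I`
at the centre (from `IsSmoothForm vol_o`) and nonzero there, so the sign is eventually constant
and nonzero. The instance `[IsContinuousRiemannianBundle …]` bound by the fact is not needed.
[cite: Lee2013, Prop. 15.5] -/
theorem isContinuousOrientation_of_isSmoothForm_riemannianVolumeForm_holds :
    isContinuousOrientation_of_isSmoothForm_riemannianVolumeForm o := by
  intro _ hvol x₀
  set g : E → ℝ := fun y ↦
    (Literature.Geometry.Kaehler.riemannianVolumeForm o).inChart x₀ y (modelBasis E n) with hg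
  have hsign : ∀ y, chartSign o x₀ y = Real.sign (g y) :=
    chartSign_eq_sign_inChart_riemannianVolumeForm o x₀
  have hcont : ContinuousWithinAt g (range I) (extChartAt I x₀ x₀) :=
    (hvol x₀).continuousWithinAt.eval_const _
  have hne : g (extChartAt I x₀ x₀) ≠ 0 :=
    inChart_riemannianVolumeForm_extChartAt_self_ne_zero o x₀
  simp only [hsign]
  rcases hne.lt_or_gt with hlt | hgt
  · filter_upwards [hcont.eventually (gt_mem_nhds hlt)] with y hy
    rw [Real.sign_of_neg hy, Real.sign_of_neg hlt]
    norm_num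
  · filter_upwards [hcont.eventually (lt_mem_nhds hgt)] with y hy
    rw [Real.sign_of_pos hy, Real.sign_of_pos hgt]
    norm_num

end Bridge

end Literature.NumberTheory.Transcendental

end
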